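import Summits.AtomisticToContinuum.Crystallization.Theorems.ChartedZeroExcessLayeredLatticeLiouvilleZZZXC

/-!
# ChartedZeroExcess · LayeredLatticeLiouville ZZZY (lens-2 g90 NODE 90 «BandTree») — the S-side leaf of record (RG-lab″) `CoreLightLabelTreeP` PROVED;
# the door of record `[MCMC♮](ϑc) ⟸ (SC♮) ∧ (X1ᴸ)(lam > 0) ∧ (X2ᴸ) ∧ (DWᴹ)(cE, 0)` (`mildCoherentMoatCorePG_W2d_exactWell`) has NO S-side combinatorial leaf left.
Route ChartedPlanarOrder, docket `stmt-AtomisticToContinuum-26636`, W2 line; executes critic rows 1597/1601 («g90: PROVE (RG-lab″) first»).  Tree ZZZXB typed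
(RG-lab″) «the labelled `16`-core carries a bounded (`N₀`), shallow (`H₀`) spanning tree, parents in label range `Rd`, `μC`-fat label tripods at INTERNAL
nodes, label diameter `ΔC`» and tree ZZZXC supplied the S-free toolkit.  THIS FILE proves it for symbolic dials (`coreLightLabelTreeP_of_regime`: `q = 4`,
`ρ = 16 < ℓ`, `Rd ≥ 112/25`, `aHi = 1`, `σ ≥ 1/2`, `ϑr ≤ 10⁻⁴`, `Rs ≥ 28/25`) with `(N₀, H₀, μC, ΔC) = (130925, 19614, 3/10, 2·19614·Rd)`, hence at the
record dials (`coreLightLabelTreeP_record`, `ΔC = 4746588/25`), and re-issues tree ZZZXB's exact-well door with `hLT` discharged.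
THE BAND TREE (lens «special vs generic» as a DICHOTOMY OF DEPTH): root `k₀ ∈ K`; band A = core atoms within `14` of `k₀`, depth `⌊100·d(·,k₀)²⌋ + 1`,
parent = ONE clean near hop toward `k₀` (`clean_hop_sq`, `d² ↓ 1/100`); band B = the rest, where `Φ := dist(·, nearest k ∈ K) ∈ (6, 16]`, depth
`⌊20Φ/27⌋ + 19602`, parent = THREE clean far hops toward the nearest container atom (`clean_hop_far_three`, `Φ ↓ 27/20`).  Hops are bonds of zone atoms,
so parent labels are within `84/25` (`dist_lab_le_of_contact`); every parent is DEEP (`dist(·, K) ≤ 239/16`), so at every internal node the twelve contacts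
are core atoms and the LABEL TRIPOD `exists_labelTripod` — the label-preimages (local label surjectivity, tree ZZZVA) of the CANONICAL TRIPLE of the
`C`-star of the node's label (cool shadow of the clean chart crystal; `canonTriple` lies in fcc AND hcp stars, tree ZZZXC) — is indexed in the core, is
`3/10`-fat (`tripodAt_of_near_canonTriple`, `2a/5 − a/16 − ϑr ≥ 0.3036`) and in range `112/25 ≤ Rd` of the grandparent; `N₀` by packing
(`(2·21·32/27 + 1)³ < 130926`), `ΔC = 2·H₀·Rd` for free (`isLightLabelTree_of_clauses`).  No case table, no graph automorphism, no boundary analysis.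
0 sorry · import = tree ZZZXC only · 0 defs · 6 theorems · no instances/notation/options · axioms standard. [g90]
-/

noncomputable section
open scoped BigOperators Classical InnerProductSpace RealInnerProductSpace
open MeasureTheory Set Metric Filter Topology
open Literature.Geometry.DiscreteGeometry (IsTwoShellGoodSet fccTwoShellPattern hcpTwoShellPattern)
open Literature.MathematicalPhysics.StatisticalMechanics (lennardJones)

namespace Summit.AtomisticToContinuum.Crystallization.Theorems.ChartedZeroExcessLayeredLatticeLiouville

open Summit.AtomisticToContinuum.Crystallization.Theorems.ChartedPlanarOrderRigidityDoor (E3 IsClean)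
open Summit.AtomisticToContinuum.Crystallization.Theorems.ChartedPlanarOrderDensityDichotomy (μS IsSep)
open Summit.AtomisticToContinuum.Crystallization.Theorems.ChartedPlanarOrderCleanScaleP (IsCleanP IsDoorSetP)
open Summit.AtomisticToContinuum.Crystallization.Theorems.ChartedPlanarOrderMesoCut (LayeredHom EnvClose)
open Summit.AtomisticToContinuum.Crystallization.Theorems.ChartedPlanarOrderDoorLayeredOsc (IsTwoShellAffineGood mem_iff_μS_singleton_ne_zero)
open Summit.AtomisticToContinuum.Crystallization.Theorems.ChartedPlanarOrderCleanStackedIndependent (setOf_μS_ne_zero)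

/-! ### ZZZY-1  Bonds of `S` go to label distance `≤ 28/25`; three far hops -/

section Hops

variable {δ ε rΘ ℓ : ℝ} {S K C : Set E3} {lab : E3 → E3}

/-- in a `1`-door set two DISTINCT zone atoms at distance `≤ 17/16` have labels at distance `≤ 28/25` (bond label clause (b) with
`isBond_iff_of_isDoorSetP`). [this file, g90] -/
theorem dist_lab_le_of_contact (hS : IsDoorSetP 1 δ S) (hlab : IsBondLabel ε rΘ ℓ S K C lab) {p p' : E3} (hp : p ∈ S) (hp' : p' ∈ S)
    (hz : ∃ k ∈ K, dist p k < ℓ) (hz' : ∃ k ∈ K, dist p' k < ℓ) (hne : p' ≠ p) (hd : dist p p' ≤ 17 / 16) :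
    dist (lab p) (lab p') ≤ 28 / 25 := by
  have hb : IsBond p p' := (isBond_iff_of_isDoorSetP le_rfl hS hp hp').2 ⟨hne.symm, by linarith⟩
  exact (hlab.2.1 p hp p' hp' hz hz' hb).2

/-- ★ **THREE FAR HOPS (PROVED)**: in a set `Y` all of whose points are `(1/16, 9/10, 1)`-two-shell-good, from `p ∈ Y` at distance `≥ 21/4` from a target
`x` there is a chain `p → p₁ → p₂ → p₃` in `Y` of consecutive contacts (`≠`, `dist ≤ 17/16`), every member no farther from `x` than `p`, ending at
`dist (p₃, x) ≤ dist (p, x) − 27/20` (`clean_hop_far` thrice; the intermediate distances stay `≥ 3`). [this file, g90] -/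
theorem clean_hop_far_three {Y : Set E3} (hY : ∀ q ∈ Y, IsTwoShellGoodSet (1 / 16) (9 / 10) 1 Y q) {p x : E3} (hp : p ∈ Y)
    (hD : 21 / 4 ≤ dist p x) :
    ∃ p₁ ∈ Y, ∃ p₂ ∈ Y, ∃ p₃ ∈ Y, p₁ ≠ p ∧ dist p p₁ ≤ 17 / 16 ∧ p₂ ≠ p₁ ∧ dist p₁ p₂ ≤ 17 / 16 ∧ p₃ ≠ p₂ ∧ dist p₂ p₃ ≤ 17 / 16 ∧
      dist p₁ x ≤ dist p x ∧ dist p₂ x ≤ dist p x ∧ dist p₃ x ≤ dist p x - 27 / 20 := by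
  obtain ⟨p₁, hp₁, hne₁, hd₁, hg₁⟩ := clean_hop_far (hY p hp) (by linarith)
  have hD₁ : 67 / 16 ≤ dist p₁ x := by
    have := dist_triangle p p₁ x
    linarith
  obtain ⟨p₂, hp₂, hne₂, hd₂, hg₂⟩ := clean_hop_far (hY p₁ hp₁) (by linarith)
  have hD₂ : 3 ≤ dist p₂ x := by
    have := dist_triangle p₁ p₂ x
    linarith
  obtain ⟨p₃, hp₃, hne₃, hd₃, hg₃⟩ := clean_hop_far (hY p₂ hp₂) hD₂
  exact ⟨p₁, hp₁, p₂, hp₂, p₃, hp₃, hne₁, hd₁, hne₂, hd₂, hne₃, hd₃, by linarith, by linarith, by linarith⟩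

end Hops

/-! ### ZZZY-2  The label tripod at a zone atom: the label-preimage of the canonical triple of the C-star (PROVED) -/

section Tripod

variable {δ σ ϑr Rs ε ε' r rI ℓ rΘ ℓ' : ℝ} {S K H : Set E3} {L' : E3 →L[ℝ] E3} {w' : ℤ → E3} {U : E3 ≃ₗᵢ[ℝ] E3} {t : E3} {lab : E3 → E3}

/-- ★★ **THE LABEL TRIPOD (PROVED)** — at an atom `p` of a `1`-door set `S` whose first shell lies in the label zone, with `C = placedCrystal L′ w′ U t`
a cool shadow crystal (`Rs ≥ 28/25`, `ϑr ≤ 10⁻⁴`, `σ ≥ 1/2`) of a CLEAN chart crystal `H` and `lab` a bond label into `C`: there are a linear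
isometry `A`, a scale `a ∈ [9/10, 1]` and THREE CONTACTS `p′ m ∈ S` of `p` (`≠ p`, `dist ≤ 17/16`) whose LABELS lie within `a/16 + ϑr` of
`lab p + a • A (canonTriple m)` and within `28/25` of `lab p`.  Mechanism: shadow the `C`-star of `c = lab p` into the clean star of `x ∈ H`
(`IsCoolShadowCrystal` (iii)), where the pattern contains the canonical triple (`canonTriple_mem_of_pattern`); transport the three `H`-sites back
by `EnvClose` (translation) and the placement — three sites of `C` BONDED to `c`; pull them back to contacts of `p` by local label surjectivity
(`exists_contact_of_bonded_label`, kissing number twelve `bonded_placed_le_twelve`).  `A = U⁻¹ ∘ A′` with `A′` the frame of the clean star.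
[this file, g90] -/
theorem exists_labelTripod (hS : IsDoorSetP 1 δ S) (hH : ∀ x ∈ H, IsTwoShellGoodSet (1 / 16) (9 / 10) 1 H x)
    (hSC : IsCoolShadowCrystal σ ϑr Rs ε r rI ℓ S K H L' w' U t) (hRs : 28 / 25 ≤ Rs) (hϑr : ϑr ≤ 1 / 10000) (hσ : 1 / 2 ≤ σ)
    (hlab : IsBondLabel ε' rΘ ℓ' S K (placedCrystal L' w' U t) lab) {p : E3} (hp : p ∈ S) (hz : ∃ k ∈ K, dist p k + 17 / 16 < ℓ') :
    ∃ (A : E3 →ₗᵢ[ℝ] E3) (a : ℝ), 9 / 10 ≤ a ∧ a ≤ 1 ∧ ∃ p' : Fin 3 → E3, ∀ m, p' m ∈ S ∧ p' m ≠ p ∧ dist p (p' m) ≤ 17 / 16 ∧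
      dist (lab (p' m)) (lab p + a • A (canonTriple m)) ≤ a / 16 + ϑr ∧ dist (lab p) (lab (p' m)) ≤ 28 / 25 := by
  have hB : ∀ c ∈ placedCrystal L' w' U t, ({c' | c' ∈ placedCrystal L' w' U t ∧ IsBond c c'}).ncard ≤ 12 ∧
      ({c' | c' ∈ placedCrystal L' w' U t ∧ IsBond c c'}).Finite :=
    fun c hc => bonded_placed_le_twelve hSC hH hRs hϑr hσ hc
  obtain ⟨-, -, hsh, -, -⟩ := hSC
  have hzℓ : ∃ k ∈ K, dist p k < ℓ' := by obtain ⟨k, hk, hkd⟩ := hz; exact ⟨k, hk, by linarith⟩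
  have hc : lab p ∈ placedCrystal L' w' U t := hlab.1 p hp hzℓ
  set c : E3 := lab p with hcdef
  set x' : E3 := U (c - t) with hx'def
  have hx' : x' ∈ LayeredHom L' w' := hc
  obtain ⟨x, hx, hE⟩ := hsh x' hx'
  obtain ⟨a, ha1, ha2, A', P, f, hP, hf, -, -⟩ := hH x hx
  have ha0 : 0 < a := by linarith
  have hcx : c = U.symm x' + t := by rw [hx'def, U.symm_apply_apply, sub_add_cancel]
  -- for each vector of the canonical triple: a site of `C` BONDED to `c`, near `c + U⁻¹ (a • A′ v)`
  have key : ∀ m : Fin 3, ∃ c' ∈ placedCrystal L' w' U t, IsBond c c' ∧ dist c' (c + U.symm (a • A' (canonTriple m))) ≤ a / 16 + ϑr := by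
    intro m
    set v : E3 := canonTriple m with hvdef
    have hvP : v ∈ P := canonTriple_mem_of_pattern hP m
    have hv1 : ‖v‖ = 1 := norm_canonTriple m
    obtain ⟨hfv, hfvd⟩ := hf v hvP
    have haAv : ‖a • A' v‖ = a := by rw [norm_smul, A'.norm_map, hv1, mul_one, Real.norm_eq_abs, abs_of_pos ha0]
    have hxav : dist (x + a • A' v) x = a := by rw [dist_eq_norm, add_sub_cancel_left, haAv]
    have hfx_up : dist (f v) x ≤ a + 1 / 16 * a := by linarith [dist_triangle (f v) (x + a • A' v) x]
    have hfx_lo : a - 1 / 16 * a ≤ dist (f v) x := by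
      have h := dist_triangle (x + a • A' v) (f v) x
      rw [hxav, dist_comm (x + a • A' v) (f v)] at h
      linarith
    obtain ⟨h', hh', hh'd⟩ := hE.2 (f v) hfv (by linarith)
    refine ⟨U.symm h' + t, ?_, ?_, ?_⟩
    · show U (U.symm h' + t - t) ∈ LayeredHom L' w'
      rwa [add_sub_cancel_right, U.apply_symm_apply]
    · -- the bond `0 < dist c c′ ≤ 28/25`: `dist c c′ = ‖h′ − x′‖ ∈ [15a/16 − ϑr, 17a/16 + ϑr]`
      have e1 : dist c (U.symm h' + t) = ‖h' - x'‖ := by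
        have e : U.symm h' + t - (U.symm x' + t) = U.symm (h' - x') := by rw [map_sub]; abel
        rw [hcx, dist_comm, dist_eq_norm, e, LinearIsometryEquiv.norm_map]
      have hw : |‖h' - x'‖ - ‖f v - x‖| ≤ ϑr := by
        have h1 := abs_norm_sub_norm_le (h' - x') (f v - x)
        rw [← dist_eq_norm] at h1
        exact h1.trans hh'd
      rw [dist_eq_norm] at hfx_up hfx_lo
      obtain ⟨hw1, hw2⟩ := abs_le.1 hw
      refine ⟨?_, ?_⟩ <;> (rw [e1]; linarith)
    · -- nearness `≤ a/16 + ϑr`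
      have e2 : U.symm h' + t - (c + U.symm (a • A' v)) = U.symm (h' - x' - a • A' v) := by
        rw [hcx, map_sub, map_sub]; abel
      rw [dist_eq_norm, e2, LinearIsometryEquiv.norm_map]
      have e3 : h' - x' - a • A' v = (h' - x' - (f v - x)) + (f v - (x + a • A' v)) := by abel
      rw [e3]
      calc ‖h' - x' - (f v - x) + (f v - (x + a • A' v))‖ ≤ ‖h' - x' - (f v - x)‖ + ‖f v - (x + a • A' v)‖ := norm_add_le _ _
        _ ≤ ϑr + 1 / 16 * a := add_le_add (by rw [← dist_eq_norm]; exact hh'd) (by rw [← dist_eq_norm]; exact hfvd)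
        _ = a / 16 + ϑr := by ring
  choose c' hc'C hbond hnear using key
  -- lift each bonded site of `c` to a contact of `p` (local label surjectivity)
  have lift : ∀ m : Fin 3, ∃ p' ∈ S, IsBond p p' ∧ dist p p' ≤ 17 / 16 ∧ lab p' = c' m := fun m =>
    exists_contact_of_bonded_label hS hlab hB hp hz (hc'C m) (hbond m)
  choose p' hp'S hpb hpd hpl using lift
  refine ⟨U.symm.toLinearIsometry.comp A', a, ha1, ha2, p', fun m => ⟨hp'S m, ?_, hpd m, ?_, ?_⟩⟩
  · intro h
    have h0 := (hpb m).1
    rw [h, dist_self] at h0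
    exact lt_irrefl _ h0
  · have e : a • (U.symm.toLinearIsometry.comp A') (canonTriple m) = U.symm (a • A' (canonTriple m)) := by
      rw [LinearIsometryEquiv.map_smul]; rfl
    rw [hpl m, e]
    exact hnear m
  · rw [hpl m]
    exact (hbond m).2

end Tripod

/-! ### ZZZY-3  The node: (RG-lab″) `CoreLightLabelTreeP` PROVED in the regime `q = 4`, `ρ = 16 < ℓ`, `Rd ≥ 112/25`, `aHi = 1` -/

section Node

open Summit.AtomisticToContinuum.Crystallization.Theorems.ChartedPlanarOrderCleanStackedIndependent (setOf_μS_ne_zero)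

variable {ϑc ϑp r rΘ rsh rm σ ϑr Rs ε rI ℓ Rd Λ θ s : ℝ}

/-- ★★★ **NODE 90 — (RG-lab″) PROVED: THE BAND TREE.**  `CoreLightLabelTreeP` for symbolic dials in the regime `q = 4`, `ρ = 16 < ℓ`, `Rd ≥ 112/25`,
`aHi = 1`, shadow dials `σ ≥ 1/2`, `ϑr ≤ 10⁻⁴`, `Rs ≥ 28/25`, with the EXPLICIT tree constants `(N₀, H₀, μC, ΔC) = (130925, 19614, 3/10, 2·19614·Rd)`.
PROOF.  COUNT: the `16`-core lies in `S ∩ ball (x₀, 21)` and `S` is `27/32`-separated (`ncard_inter_ball_le_packing`: `(2·21·32/27 + 1)³ < 130926`).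
TREE: root `k₀ ∈ K` (the core is non-empty, `K ⊆ core`); DEPTH of an atom `p ≠ k₀`: band A (`dist (p, k₀) ≤ 14`) `⌊100·dist (p, k₀)²⌋ + 1 ≤ 19601`,
band B (`dist (p, k₀) > 14`, so `Φ(p) := dist (p, nearest k ∈ K) ∈ (6, 16]`) `⌊20Φ(p)/27⌋ + 19602 ≤ 19614`; PARENT: band A — one clean near hop toward
`k₀` (`clean_hop_sq`: squared distance drops by `≥ 1/100`, so the depth drops and the parent stays in band A or is the root); band B — THREE clean far
hops toward the nearest container atom (`clean_hop_far_three`: `Φ` drops by `≥ 27/20`, so either the parent left band B — depth `≤ 19601 < 19602` —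
or its depth index dropped by `≥ 1`).  Consecutive hops are bonds of zone atoms, so parent labels are within `3·28/25 = 84/25 ≤ Rd`
(`dist_lab_le_of_contact`).  EVERY PARENT IS DEEP (`dist (·, K) ≤ 239/16`: band-A parents are within `14` of `k₀`, band-B parents within
`16 − 27/20` of their container atom), so its twelve contacts lie in the `16`-core and in the zone: at every internal node the LABEL TRIPOD
(`exists_labelTripod`) is indexed by core sites and is `(2/5·a − a/16 − ϑr ≥ 3/10)`-fat (`tripodAt_of_near_canonTriple`), in range `84/25 + 28/25 =
112/25 ≤ Rd` of the grandparent; the diameter `2·H₀·Rd` is free (`isLightLabelTree_of_clauses`).  KINEMATIC · LJ-free · y-free · V-free · S-side. [this file, g90] -/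
theorem coreLightLabelTreeP_of_regime (hσ : 1 / 2 ≤ σ) (hϑr : ϑr ≤ 1 / 10000) (hRs : 28 / 25 ≤ Rs) (hℓ : 16 < ℓ) (hRd : 112 / 25 ≤ Rd) :
    CoreLightLabelTreeP ϑc ϑp r rΘ 4 rsh 16 rm σ ϑr Rs ε rI ℓ Rd 130925 19614 (3 / 10) (2 * 19614 * Rd) 1 Λ θ s := by
  intro δ hδ a ha S hS hsum hgood L w hLw x₀ K hKS hKq hmild hcool n xf hxf hrange L' w' U t hSC lab hlab
  set H : Set E3 := LayeredHom (L : E3 →L[ℝ] E3) w with hHdef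
  have hsepS : IsSep (27 / 32) S := isSep_of_isDoorSetP le_rfl hS
  have hSgood : ∀ q ∈ S, IsTwoShellGoodSet (1 / 16) (9 / 10) 1 S q := fun q hq => isTwoShellGoodSet_of_isDoorSetP hS hq
  have hH : ∀ x ∈ H, IsTwoShellGoodSet (1 / 16) (9 / 10) 1 H x := by
    intro x hx
    have hcl := hLw.2.2.2.1
    have h := hcl x ((mem_iff_μS_singleton_ne_zero H x).2 hx)
    rwa [setOf_μS_ne_zero] at h
  -- the enumerated core
  have hcore : ∀ i, xf i ∈ S ∧ ∃ k ∈ K, dist (xf i) k ≤ 16 := fun i => by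
    have h : xf i ∈ coreOf S K 16 := by rw [← hrange]; exact Set.mem_range_self i
    exact h
  have hidx : ∀ p ∈ S, (∃ k ∈ K, dist p k ≤ 16) → ∃ i, xf i = p := fun p hp hk => by
    have h : p ∈ coreOf S K 16 := ⟨hp, hk⟩
    rw [← hrange] at h
    exact h
  -- (1) THE COUNT
  have hN : n ≤ 130925 := by
    have hsub : Set.range xf ⊆ S ∩ ball x₀ 21 := by
      rintro p ⟨i, rfl⟩
      obtain ⟨hpS, k, hk, hkd⟩ := hcore i
      refine ⟨hpS, mem_ball.2 ?_⟩
      calc dist (xf i) x₀ ≤ dist (xf i) k + dist k x₀ := dist_triangle _ _ _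
        _ < 21 := by linarith [hKq k hk]
    have hfin := finite_inter_ball_of_isSep (by norm_num : (0 : ℝ) < 27 / 32) hsepS x₀ 21
    have h1 : (Set.range xf).ncard = n := by
      rw [Set.ncard_range_of_injective hxf, Nat.card_eq_fintype_card, Fintype.card_fin]
    have h2 : (Set.range xf).ncard ≤ (S ∩ ball x₀ 21).ncard := Set.ncard_le_ncard hsub hfin
    have h3 := ncard_inter_ball_le_packing (by norm_num : (0 : ℝ) < 27 / 32) hsepS x₀ (by norm_num : (0 : ℝ) ≤ 21)
    have h4 : ((S ∩ ball x₀ 21).ncard : ℝ) < 130926 := lt_of_le_of_lt h3 (by norm_num)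
    have h5 : ((Set.range xf).ncard : ℝ) ≤ ((S ∩ ball x₀ 21).ncard : ℝ) := by exact_mod_cast h2
    have h6 : (n : ℝ) < 130926 := by rw [← h1]; linarith
    have h7 : n < 130926 := by exact_mod_cast h6
    omega
  refine ⟨hN, fun hn => ?_⟩
  -- (2) THE ROOT, the nearest container atom
  have i₁ : Fin n := ⟨0, Nat.pos_of_ne_zero hn⟩
  obtain ⟨-, k₀, hk₀K, -⟩ := hcore i₁
  have hk₀S : k₀ ∈ S := hKS hk₀K
  obtain ⟨i₀, hi₀⟩ := hidx k₀ hk₀S ⟨k₀, hk₀K, by rw [dist_self]; norm_num⟩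
  have hKfin : K.Finite := by
    refine (finite_inter_ball_of_isSep (by norm_num : (0 : ℝ) < 27 / 32) hsepS x₀ 5).subset fun k hk => ⟨hKS hk, mem_ball.2 ?_⟩
    linarith [hKq k hk]
  have hkn : ∀ p : E3, ∃ k ∈ K, ∀ k' ∈ K, dist p k ≤ dist p k' := fun p =>
    Set.exists_min_image K (fun k => dist p k) hKfin ⟨k₀, hk₀K⟩
  choose kn hknK hknmin using hkn
  have hKK : ∀ k ∈ K, ∀ k' ∈ K, dist k k' ≤ 8 := fun k hk k' hk' => by
    calc dist k k' ≤ dist k x₀ + dist k' x₀ := dist_triangle_right _ _ _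
      _ ≤ 8 := by linarith [hKq k hk, hKq k' hk']
  have hΦle : ∀ i, dist (xf i) (kn (xf i)) ≤ 16 := fun i => by
    obtain ⟨-, k, hk, hkd⟩ := hcore i
    exact (hknmin (xf i) k hk).trans hkd
  have hsep0 : ∀ i, xf i ≠ k₀ → 27 / 32 ≤ dist (xf i) k₀ := fun i h => hsepS (xf i) (hcore i).1 k₀ hk₀S h
  -- (3) THE DEPTH: band A `dist (·, k₀) ≤ 14`, band B beyond
  obtain ⟨dep, hdepdef⟩ : ∃ dep : Fin n → ℕ, ∀ i, dep i = if xf i = k₀ then 0 else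
      if dist (xf i) k₀ ≤ 14 then ⌊100 * dist (xf i) k₀ ^ 2⌋₊ + 1 else ⌊20 * dist (xf i) (kn (xf i)) / 27⌋₊ + 19602 :=
    ⟨fun i => if xf i = k₀ then 0 else if dist (xf i) k₀ ≤ 14 then ⌊100 * dist (xf i) k₀ ^ 2⌋₊ + 1 else ⌊20 * dist (xf i) (kn (xf i)) / 27⌋₊ + 19602,
      fun i => rfl⟩
  have hdepA : ∀ i, xf i ≠ k₀ → dist (xf i) k₀ ≤ 14 → dep i = ⌊100 * dist (xf i) k₀ ^ 2⌋₊ + 1 := fun i h1 h2 => by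
    rw [hdepdef, if_neg h1, if_pos h2]
  have hdepB : ∀ i, ¬ dist (xf i) k₀ ≤ 14 → dep i = ⌊20 * dist (xf i) (kn (xf i)) / 27⌋₊ + 19602 := fun i h2 => by
    have h1 : xf i ≠ k₀ := fun h => h2 (by rw [h, dist_self]; norm_num)
    rw [hdepdef, if_neg h1, if_neg h2]
  have hne_k₀ : ∀ j, dep j ≠ 0 → xf j ≠ k₀ := fun j hj h => hj ((hdepdef j).trans (if_pos h))
  have hroot : ∀ j, dep j = 0 → j = i₀ := fun j hj => by
    by_contra hne
    have h1 : xf j ≠ k₀ := fun h => hne (hxf (h.trans hi₀.symm))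
    by_cases h2 : dist (xf j) k₀ ≤ 14
    · rw [hdepA j h1 h2] at hj; exact Nat.succ_ne_zero _ hj
    · rw [hdepB j h2] at hj; omega
  have hbandA : ∀ j, dist (xf j) k₀ ≤ 14 → ⌊100 * dist (xf j) k₀ ^ 2⌋₊ ≤ 19600 := fun j h2 => by
    apply Nat.floor_le_of_le
    push_cast
    nlinarith [dist_nonneg (x := xf j) (y := k₀)]
  have hHle : ∀ j, dep j ≤ 19614 := fun j => by
    by_cases h1 : xf j = k₀
    · rw [hdepdef, if_pos h1]; exact Nat.zero_le _
    by_cases h2 : dist (xf j) k₀ ≤ 14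
    · rw [hdepA j h1 h2]; linarith [hbandA j h2]
    · rw [hdepB j h2]
      have : ⌊20 * dist (xf j) (kn (xf j)) / 27⌋₊ ≤ 12 := by
        apply Nat.floor_le_of_le
        push_cast
        linarith [hΦle j]
      omega
  -- (4) THE PARENT: one near hop (band A) / three far hops (band B); depth drops, labels within `84/25`, the parent is DEEP
  have hpar : ∀ i, ∃ j, xf i ≠ k₀ → dep j < dep i ∧ dist (lab (xf j)) (lab (xf i)) ≤ 84 / 25 ∧ ∃ k ∈ K, dist (xf j) k ≤ 239 / 16 := by
    intro i
    by_cases h1 : xf i = k₀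
    · exact ⟨i₀, fun h => absurd h1 h⟩
    obtain ⟨hiS, hik⟩ := hcore i
    by_cases h2 : dist (xf i) k₀ ≤ 14
    · -- band A
      have hD : 4 / 5 ≤ dist (xf i) k₀ := by linarith [hsep0 i h1]
      obtain ⟨q', hq'S, hq'ne, hq'd, hgain⟩ := clean_hop_sq (hSgood (xf i) hiS) hD
      have hq'k₀ : dist q' k₀ ≤ dist (xf i) k₀ := by
        nlinarith [dist_nonneg (x := q') (y := k₀), dist_nonneg (x := xf i) (y := k₀)]
      obtain ⟨j, hj⟩ := hidx q' hq'S ⟨k₀, hk₀K, by linarith⟩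
      refine ⟨j, fun _ => ⟨?_, ?_, k₀, hk₀K, by rw [hj]; linarith⟩⟩
      · rw [hdepA i h1 h2]
        by_cases hj0 : xf j = k₀
        · rw [hdepdef j, if_pos hj0]; exact Nat.succ_pos _
        · rw [hdepA j hj0 (by rw [hj]; linarith), hj]
          have h0 : (0 : ℝ) ≤ 100 * dist (xf i) k₀ ^ 2 - 1 := by nlinarith
          have e : ⌊100 * dist (xf i) k₀ ^ 2⌋₊ = ⌊100 * dist (xf i) k₀ ^ 2 - 1⌋₊ + 1 := by
            rw [← Nat.floor_add_one h0, sub_add_cancel]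
          rw [e]
          have : ⌊100 * dist q' k₀ ^ 2⌋₊ ≤ ⌊100 * dist (xf i) k₀ ^ 2 - 1⌋₊ := Nat.floor_le_floor (by linarith)
          omega
      · rw [hj, dist_comm]
        exact (dist_lab_le_of_contact hS hlab hiS hq'S ⟨k₀, hk₀K, by linarith⟩ ⟨k₀, hk₀K, by linarith⟩ hq'ne hq'd).trans (by norm_num)
    · -- band B
      have hk₁K : kn (xf i) ∈ K := hknK (xf i)
      have hΦ : dist (xf i) (kn (xf i)) ≤ 16 := hΦle i
      have hΦ6 : 6 < dist (xf i) (kn (xf i)) := by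
        have h14 : 14 < dist (xf i) k₀ := lt_of_not_ge h2
        have := dist_triangle (xf i) (kn (xf i)) k₀
        linarith [hKK (kn (xf i)) hk₁K k₀ hk₀K]
      obtain ⟨p₁, hp₁, p₂, hp₂, p₃, hp₃, hne₁, hd₁, hne₂, hd₂, hne₃, hd₃, hx₁, hx₂, hx₃⟩ :=
        clean_hop_far_three hSgood hiS (by linarith : (21 : ℝ) / 4 ≤ dist (xf i) (kn (xf i)))
      obtain ⟨j, hj⟩ := hidx p₃ hp₃ ⟨kn (xf i), hk₁K, by linarith⟩
      refine ⟨j, fun _ => ⟨?_, ?_, kn (xf i), hk₁K, by rw [hj]; linarith⟩⟩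
      · rw [hdepB i h2]
        by_cases hj0 : xf j = k₀
        · rw [hdepdef j, if_pos hj0]; omega
        by_cases hjA : dist (xf j) k₀ ≤ 14
        · rw [hdepA j hj0 hjA]; linarith [hbandA j hjA]
        · rw [hdepB j hjA, hj]
          have hmin : dist p₃ (kn p₃) ≤ dist p₃ (kn (xf i)) := hknmin p₃ (kn (xf i)) hk₁K
          have h0 : (0 : ℝ) ≤ 20 * dist (xf i) (kn (xf i)) / 27 - 1 := by linarith
          have e : ⌊20 * dist (xf i) (kn (xf i)) / 27⌋₊ = ⌊20 * dist (xf i) (kn (xf i)) / 27 - 1⌋₊ + 1 := by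
            rw [← Nat.floor_add_one h0, sub_add_cancel]
          rw [e]
          have : ⌊20 * dist p₃ (kn p₃) / 27⌋₊ ≤ ⌊20 * dist (xf i) (kn (xf i)) / 27 - 1⌋₊ := Nat.floor_le_floor (by linarith)
          omega
      · rw [hj, dist_comm]
        have hz0 : ∃ k ∈ K, dist (xf i) k < ℓ := ⟨kn (xf i), hk₁K, by linarith⟩
        have hz1 : ∃ k ∈ K, dist p₁ k < ℓ := ⟨kn (xf i), hk₁K, by linarith⟩
        have hz2 : ∃ k ∈ K, dist p₂ k < ℓ := ⟨kn (xf i), hk₁K, by linarith⟩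
        have hz3 : ∃ k ∈ K, dist p₃ k < ℓ := ⟨kn (xf i), hk₁K, by linarith⟩
        have e1 := dist_lab_le_of_contact hS hlab hiS hp₁ hz0 hz1 hne₁ hd₁
        have e2 := dist_lab_le_of_contact hS hlab hp₁ hp₂ hz1 hz2 hne₂ hd₂
        have e3 := dist_lab_le_of_contact hS hlab hp₂ hp₃ hz2 hz3 hne₃ hd₃
        linarith [dist_triangle (lab (xf i)) (lab p₁) (lab p₃), dist_triangle (lab p₁) (lab p₂) (lab p₃)]
  choose par hpar using hpar
  -- (5) THE TRIPODS at deep non-root nodes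
  have htri : ∀ j, ∃ tr : Fin 3 → Fin n, (xf j ≠ k₀ ∧ ∃ k ∈ K, dist (xf j) k ≤ 239 / 16) →
      TripodAt Rd (3 / 10) (fun i => lab (xf i)) (par j) j tr := by
    intro j
    by_cases hj : xf j ≠ k₀ ∧ ∃ k ∈ K, dist (xf j) k ≤ 239 / 16
    · obtain ⟨hj0, k, hk, hkd⟩ := hj
      obtain ⟨A, a', ha1, ha2, p', hp'⟩ := exists_labelTripod hS hH hSC hRs hϑr hσ hlab (hcore j).1 ⟨k, hk, by linarith⟩
      have hidx' : ∀ m, ∃ i, xf i = p' m := fun m => by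
        obtain ⟨hpS, -, hpd, -, -⟩ := hp' m
        refine hidx (p' m) hpS ⟨k, hk, ?_⟩
        linarith [dist_triangle_left (p' m) k (xf j)]
      choose tr htr using hidx'
      have hnear : ∀ m, dist (lab (xf (tr m))) (lab (xf j) + a' • A (canonTriple m)) ≤ a' / 16 + ϑr := fun m => by
        rw [htr m]; exact (hp' m).2.2.2.1
      have hpj : dist (lab (xf (par j))) (lab (xf j)) ≤ 84 / 25 := (hpar j hj0).2.1
      have hrng : ∀ m, dist (lab (xf (par j))) (lab (xf (tr m))) ≤ Rd ∧ dist (lab (xf j)) (lab (xf (tr m))) ≤ Rd := fun m => by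
        rw [htr m]
        have h2 := (hp' m).2.2.2.2
        exact ⟨by linarith [dist_triangle (lab (xf (par j))) (lab (xf j)) (lab (p' m))], by linarith⟩
      have hμ' : (3 : ℝ) / 10 ≤ 2 / 5 * a' - (a' / 16 + ϑr) := by linarith
      exact ⟨tr, fun _ => tripodAt_of_near_canonTriple A (by linarith) hnear (by norm_num) hμ' hrng⟩
    · exact ⟨fun _ => i₀, fun h => absurd h hj⟩
  choose tri htri using htri
  -- (6) ASSEMBLY (diameter for free)
  have hdec : ∀ j, dep j ≠ 0 → dep (par j) < dep j := fun j hj => (hpar j (hne_k₀ j hj)).1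
  have hparR : ∀ j, dep j ≠ 0 → dist (lab (xf (par j))) (lab (xf j)) ≤ Rd := fun j hj => by
    linarith [(hpar j (hne_k₀ j hj)).2.1]
  have htriR : ∀ i, dep i ≠ 0 → dep (par i) ≠ 0 → TripodAt Rd (3 / 10) (fun i => lab (xf i)) (par (par i)) (par i) (tri (par i)) :=
    fun i hi hpi => htri (par i) ⟨hne_k₀ (par i) hpi, (hpar i (hne_k₀ i hi)).2.2⟩
  have hT := isLightLabelTree_of_clauses (y₀ := fun i => lab (xf i)) (μ := 3 / 10) (t := tri) (by linarith : (0 : ℝ) ≤ Rd) hroot hdec hHle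
    hparR htriR
  have e : ((19614 : ℕ) : ℝ) = 19614 := by norm_num
  rw [e] at hT
  exact ⟨i₀, par, dep, tri, hT⟩

/-- ★★★ **(RG-lab″) AT THE RECORD DIALS (PROVED)** — the instance consumed by the door of record `mildCoherentMoatCorePG_W2c_exactWell_light` (tree ZZZXB):
`(N₀, H₀, μC, ΔC) = (130925, 19614, 3/10, 4746588/25)`; `0 < N₀`, `0 < H₀`, `249/20000 < μC`, `0 ≤ ΔC` hold by `norm_num`. [this file, g90] -/
theorem coreLightLabelTreeP_record (ϑc : ℝ) :
    CoreLightLabelTreeP ϑc (1 / 10) 8 (145 / 16) 4 12 16 16 (17 / 20) (1 / 10000) 5 (1 / 10000) 10 (43 / 2) (121 / 25) 130925 19614 (3 / 10)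
      (4746588 / 25) 1 2 (1 / 16) (1 / 50) := by
  have h := coreLightLabelTreeP_of_regime (ϑc := ϑc) (ϑp := 1 / 10) (r := 8) (rΘ := 145 / 16) (rsh := 12) (rm := 16) (ε := 1 / 10000)
    (rI := 10) (Λ := 2) (θ := 1 / 16) (s := 1 / 50) (σ := 17 / 20) (ϑr := 1 / 10000) (Rs := 5) (ℓ := 43 / 2) (Rd := 121 / 25)
    (by norm_num) (by norm_num) (by norm_num) (by norm_num) (by norm_num)
  rw [show (2 * 19614 * (121 / 25) : ℝ) = 4746588 / 25 by norm_num] at h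
  exact h

/-- ★★★★ **THE DOOR OF RECORD WITH (RG-lab″) DISCHARGED (PROVED) — `[MCMC♮](ϑc) ⟸ (SC♮) ∧ (X1ᴸ)(lam > 0) ∧ (X2ᴸ) ∧ (DWᴹ)(cE, 0)`, `0 < cE`.**
Tree ZZZXB's `mildCoherentMoatCorePG_W2c_exactWell_light` with `hLT` supplied by `coreLightLabelTreeP_record`.  Residual deciding leaves of the W2 line
after this node: (SC♮) `CoherentZoneShadowCrystalP` [KINEMATIC · ATTACKABLE], (X1ᴸ) `LabelTubeConvexityP` / (X2ᴸ) `LabelLoadedTubeAprioriP`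
[ANALYTIC · HEAVY], (DWᴹ)(cE, 0) `DeficitWellMinP` [ENERGETIC · exact well] — NO S-side combinatorial leaf remains. [this file, g90] -/
theorem mildCoherentMoatCorePG_W2d_exactWell {ϑc sb₁ dI₁ dB₁ lam cE : ℝ} (hlam : 0 < lam) (hcE : 0 < cE) (hsb : 4 * sb₁ ≤ 249 / 5000)
    (hdI : 4 * dI₁ ≤ 249 / 5000) (hdB : dB₁ ≤ 2 / 5) (hsb₀ : 0 ≤ sb₁) (hdI₀ : 0 ≤ dI₁) (hdB₀ : 0 ≤ dB₁)
    (hSC : CoherentZoneShadowCrystalP ϑc (1 / 10) 8 4 12 16 (17 / 20) (1 / 10000) 5 (1 / 10000) 10 (43 / 2) 1 2 (1 / 16) (1 / 50))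
    (hX1 : LabelTubeConvexityP ϑc tameRadius (1 / 10) 8 (145 / 16) 4 12 16 16 (17 / 20) (1 / 10000) 5 (1 / 10000) 10 (43 / 2) (1 / 5000) (121 / 25)
      (249 / 5000) (249 / 5000) (21 / 50) lam 1 2 (1 / 16) (1 / 50))
    (hX2 : LabelLoadedTubeAprioriP ϑc tameRadius (1 / 10) 8 (145 / 16) 4 12 16 16 (17 / 20) (1 / 10000) 5 (1 / 10000) 10 (43 / 2) (1 / 5000)
      (121 / 25) (249 / 5000) (249 / 5000) (21 / 50) sb₁ dI₁ dB₁ 1 2 (1 / 16) (1 / 50))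
    (hDW : DeficitWellMinP ϑc tameRadius (1 / 10) 8 (145 / 16) 4 12 16 16 (17 / 20) (1 / 10000) 5 (1 / 10000) 10 (43 / 2) (121 / 25) sb₁ dI₁ dB₁
      (121 / 25) cE 0 1 2 (1 / 16) (1 / 50)) :
    MildCoherentMoatCorePG ϑc tameRadius (1 / 10) 8 4 12 16 1 2 (1 / 16) (1 / 50) :=
  mildCoherentMoatCorePG_W2c_exactWell_light hlam hcE (by norm_num) (by norm_num) (by norm_num) (by norm_num) hsb hdI hdB hsb₀ hdI₀ hdB₀ hSC hX1 hX2
    (coreLightLabelTreeP_record ϑc) hDW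

end Node

end Summit.AtomisticToContinuum.Crystallization.Theorems.ChartedZeroExcessLayeredLatticeLiouville

end
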